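import Literature.NumberTheory.LFunctions.SinnottUnitsModPrimePower
import Mathlib.RingTheory.ZMod.UnitsCyclic
import Mathlib.NumberTheory.DirichletCharacter.Basic
import Mathlib.RingTheory.RootsOfUnity.Complex
import HarnessLib

/-!
# Dirichlet characters of the second kind modulo `M^m` with kernel exactly `V`

Topic `Literature/NumberTheory/LFunctions`; namespace
`Literature.NumberTheory.LFunctions.Sinnott1987`.  THEOREMS and auxiliary definitions (`gen₀`,
`secondKindHom`); no named fact.

For a prime `M` and `m > depth M` (`depth M = 1` for odd `M`, `= 2` for `M = 2`) we construct, over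
any field containing a primitive `M^{m - depth M}`-th root of unity `ζ`, a Dirichlet character `ψ`
modulo `M^m` whose kernel on `(ℤ/M^m)ˣ = V × U` is EXACTLY the torsion `V` (`IsTors` of
`SinnottUnitsModPrimePower`): `ψ(v · g₀ᵗ) = ζᵗ` for `v ∈ V`, `g₀ = 1 + M^{depth M}` the generator
of `U` (of order `M^{m - depth M}`, Mathlib `ZMod.orderOf_one_add_prime`, `ZMod.orderOf_five`).
Such a `ψ` is primitive of conductor `M^m` (`exists_secondKind`).  These are the "characters of the
second kind" `ψ` with `ker ψ = V` over which Washington's theorem (Sinnott 1987, Thm. 4.4 / §4.5)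
is quantified in `WashingtonSinnottTheorem`.

## References

* W. Sinnott, *On a theorem of L. Washington*, Astérisque 147–148 (1987), 209–224, §1.1, §4.5.
  [Sinnott1987]
* L. C. Washington, *Introduction to Cyclotomic Fields*, GTM 83 (1997), §7.2 (characters of the
  second kind). [Washington1997]
-/

noncomputable section

open Finset

namespace Literature.NumberTheory.LFunctions.Sinnott1987

variable {M : ℕ} [hM : Fact M.Prime] {m : ℕ}

/-! ### The generator `g₀ = 1 + M^{depth M}` of `U` -/

/-- `g₀ = 1 + M^{depth M}` as a unit of `ℤ/M^m`. [cite: Sinnott1987, §1.1] -/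
def gen₀ (m : ℕ) : (ZMod (M ^ m))ˣ := unitOneAdd m (depth M) 1

omit hM in
/-- The residue class of `g₀` is `1 + M^{depth M}`. [folklore] -/
theorem coe_gen₀ : ((gen₀ m : (ZMod (M ^ m))ˣ) : ZMod (M ^ m)) = 1 + (M : ZMod (M ^ m)) ^ depth M := by
  rw [gen₀, coe_unitOneAdd (one_le_depth M)]
  push_cast
  ring

/-- **`g₀` has order `M^{m - depth M}`** (`depth M ≤ m`; Mathlib `ZMod.orderOf_one_add_prime`,
`ZMod.orderOf_five`). [cite: Sinnott1987, §1.1] -/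
theorem orderOf_gen₀ (hm : depth M ≤ m) : orderOf (gen₀ m : (ZMod (M ^ m))ˣ) = M ^ (m - depth M) := by
  rw [← orderOf_units, coe_gen₀]
  obtain ⟨n, rfl⟩ : ∃ n, m = n + depth M := ⟨m - depth M, by omega⟩
  rw [Nat.add_sub_cancel]
  by_cases h2 : M = 2
  · subst h2
    have hd : depth 2 = 2 := by unfold depth; rw [if_pos rfl]
    rw [hd]
    have : (1 + ((2 : ℕ) : ZMod (2 ^ (n + 2))) ^ 2) = 5 := by push_cast; norm_num
    rw [this]
    exact ZMod.orderOf_five n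
  · have hd : depth M = 1 := by unfold depth; rw [if_neg h2]
    rw [hd, pow_one]
    exact ZMod.orderOf_one_add_prime hM.out h2 n

/-- `g₀ ≡ 1 (mod M^{depth M})` (`depth M < m`). [folklore] -/
theorem congOne_gen₀ (hm : depth M < m) : CongOne (depth M) ((gen₀ m : (ZMod (M ^ m))ˣ) : ZMod (M ^ m)) :=
  congOne_unitOneAdd (one_le_depth M) hm.le (Nat.one_lt_pow (Nat.sub_ne_zero_of_lt hm) hM.out.one_lt)

/-- Powers of `g₀` are `≡ 1 (mod M^{depth M})`. [folklore] -/
theorem congOne_gen₀_pow (hm : depth M < m) (t : ℕ) :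
    CongOne (depth M) (((gen₀ m : (ZMod (M ^ m))ˣ) ^ t : (ZMod (M ^ m))ˣ) : ZMod (M ^ m)) := by
  rw [Units.val_pow_eq_pow_val]
  exact (congOne_gen₀ hm).pow hm.le (le_trans (one_le_depth M) hm.le) t

/-- **`U = ⟨g₀⟩`**: every unit `≡ 1 (mod M^{depth M})` is a power `g₀ᵗ`, `t < M^{m - depth M}`
(both sets have `M^{m - depth M}` elements). [cite: Sinnott1987, §1.1] -/
theorem exists_pow_gen₀_eq (hm : depth M < m) {w : (ZMod (M ^ m))ˣ}
    (hw : CongOne (depth M) (w : ZMod (M ^ m))) :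
    ∃ t : ℕ, t < M ^ (m - depth M) ∧ gen₀ m ^ t = w := by
  classical
  set S := univ.filter (fun u : (ZMod (M ^ m))ˣ ↦ CongOne (depth M) (u : ZMod (M ^ m))) with hS
  set T := (range (M ^ (m - depth M))).image (fun t ↦ (gen₀ m : (ZMod (M ^ m))ˣ) ^ t) with hT
  have hTS : T ⊆ S := by
    intro u hu
    rw [hT, mem_image] at hu
    obtain ⟨t, -, rfl⟩ := hu
    rw [hS, mem_filter]
    exact ⟨mem_univ _, congOne_gen₀_pow hm t⟩
  have hinj : Set.InjOn (fun t ↦ (gen₀ m : (ZMod (M ^ m))ˣ) ^ t) (range (M ^ (m - depth M)) : Finset ℕ) := by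
    have := pow_injOn_Iio_orderOf (x := (gen₀ m : (ZMod (M ^ m))ˣ))
    rw [orderOf_gen₀ hm.le] at this
    intro a ha b hb h
    exact this (by simpa using ha) (by simpa using hb) h
  have hcardT : T.card = M ^ (m - depth M) := by
    rw [hT, card_image_of_injOn hinj, card_range]
  have hcardS : S.card = M ^ (m - depth M) := card_filter_congOne (one_le_depth M) hm.le
  have hTS' : T = S := eq_of_subset_of_card_le hTS (by rw [hcardT, hcardS])
  have hw' : w ∈ T := by
    rw [hTS', hS, mem_filter]
    exact ⟨mem_univ _, hw⟩
  rw [hT, mem_image] at hw'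
  obtain ⟨t, ht, htw⟩ := hw'
  exact ⟨t, mem_range.mp ht, htw⟩

/-! ### The decomposition `u = v · g₀ᵗ` -/

/-- **`u = v · g₀ᵗ` with `v ∈ V`** (`depth M < m`). [cite: Sinnott1987, §1.1] -/
theorem exists_decomp_gen₀ (hm : depth M < m) (u : (ZMod (M ^ m))ˣ) :
    ∃ v : (ZMod (M ^ m))ˣ, ∃ t : ℕ, IsTors v ∧ u = v * gen₀ m ^ t := by
  obtain ⟨v, w, hv, hw, huvw⟩ :=
    decomp_exists (j := depth M) le_rfl hm.le u (isTors_pow_pow_sub_depth hm.le u)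
  obtain ⟨t, -, rfl⟩ := exists_pow_gen₀_eq hm hw
  exact ⟨v, t, hv, huvw⟩

/-- Uniqueness of `u = v · g₀ᵗ`: `v` is determined and `t` is determined modulo `M^{m - depth M}`.
[cite: Sinnott1987, §1.1] -/
theorem decomp_gen₀_unique (hm : depth M < m) {v v' : (ZMod (M ^ m))ˣ} {t t' : ℕ} (hv : IsTors v)
    (hv' : IsTors v') (h : v * gen₀ m ^ t = v' * gen₀ m ^ t') :
    v = v' ∧ t ≡ t' [MOD M ^ (m - depth M)] := by
  obtain ⟨hvv, htt⟩ := decomp_unique (j := depth M) le_rfl hm.le hv (congOne_gen₀_pow hm t) hv'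
    (congOne_gen₀_pow hm t') h
  refine ⟨hvv, ?_⟩
  rw [← orderOf_gen₀ hm.le]
  exact pow_eq_pow_iff_modEq.mp htt

/-- The `V`-component of a unit. [folklore] -/
def tame₀ (hm : depth M < m) (u : (ZMod (M ^ m))ˣ) : (ZMod (M ^ m))ˣ :=
  (exists_decomp_gen₀ hm u).choose

/-- The exponent `t` of the `U`-component `g₀ᵗ` of a unit. [folklore] -/
def expo₀ (hm : depth M < m) (u : (ZMod (M ^ m))ˣ) : ℕ :=
  (exists_decomp_gen₀ hm u).choose_spec.choose

/-- The defining properties of `tame₀`, `expo₀`. [folklore] -/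
theorem tame₀_spec (hm : depth M < m) (u : (ZMod (M ^ m))ˣ) :
    IsTors (tame₀ hm u) ∧ u = tame₀ hm u * gen₀ m ^ expo₀ hm u :=
  (exists_decomp_gen₀ hm u).choose_spec.choose_spec

/-! ### The character -/

section Char

variable {K : Type*} [Field K] {ζ : K}

/-- **The second-kind character `ψ(v · g₀ᵗ) = ζᵗ`** on `(ℤ/M^m)ˣ`, for a primitive
`M^{m - depth M}`-th root of unity `ζ`. [cite: Sinnott1987, §4.5] [cite: Washington1997, §7.2] -/
def secondKindHom (hm : depth M < m) (hζ : IsPrimitiveRoot ζ (M ^ (m - depth M))) :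
    (ZMod (M ^ m))ˣ →* Kˣ where
  toFun u := (hζ.isUnit (pow_ne_zero _ hM.out.ne_zero)).unit ^ expo₀ hm u
  map_one' := by
    have horder : orderOf (hζ.isUnit (pow_ne_zero _ hM.out.ne_zero)).unit = M ^ (m - depth M) :=
      (hζ.isUnit_unit (pow_ne_zero _ hM.out.ne_zero)).eq_orderOf.symm
    have h := tame₀_spec hm 1
    have h1 : (1 : (ZMod (M ^ m))ˣ) * gen₀ m ^ 0 = tame₀ hm 1 * gen₀ m ^ expo₀ hm 1 := by
      rw [pow_zero, mul_one]; exact h.2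
    obtain ⟨-, ht⟩ := decomp_gen₀_unique hm isTors_one h.1 h1
    have key : (hζ.isUnit (pow_ne_zero _ hM.out.ne_zero)).unit ^ expo₀ hm 1 =
        (hζ.isUnit (pow_ne_zero _ hM.out.ne_zero)).unit ^ 0 :=
      pow_eq_pow_iff_modEq.mpr (by rw [horder]; exact ht.symm)
    rw [key, pow_zero]
  map_mul' u u' := by
    have horder : orderOf (hζ.isUnit (pow_ne_zero _ hM.out.ne_zero)).unit = M ^ (m - depth M) :=
      (hζ.isUnit_unit (pow_ne_zero _ hM.out.ne_zero)).eq_orderOf.symm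
    have hu := tame₀_spec hm u
    have hu' := tame₀_spec hm u'
    have huu := tame₀_spec hm (u * u')
    have h1 : tame₀ hm (u * u') * gen₀ m ^ expo₀ hm (u * u') =
        (tame₀ hm u * tame₀ hm u') * gen₀ m ^ (expo₀ hm u + expo₀ hm u') := by
      rw [← huu.2, pow_add, mul_mul_mul_comm, ← hu.2, ← hu'.2]
    obtain ⟨-, ht⟩ := decomp_gen₀_unique hm huu.1 (hu.1.mul hu'.1) h1
    rw [← pow_add]
    exact pow_eq_pow_iff_modEq.mpr (by rw [horder]; exact ht)

/-- The value of the second-kind character on `v · g₀ᵗ` is `ζᵗ`. [folklore] -/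
theorem secondKindHom_apply_decomp (hm : depth M < m) (hζ : IsPrimitiveRoot ζ (M ^ (m - depth M)))
    {v : (ZMod (M ^ m))ˣ} (hv : IsTors v) (t : ℕ) :
    ((secondKindHom hm hζ (v * gen₀ m ^ t) : Kˣ) : K) = ζ ^ t := by
  have h0 : M ^ (m - depth M) ≠ 0 := pow_ne_zero _ hM.out.ne_zero
  have horder : orderOf (hζ.isUnit h0).unit = M ^ (m - depth M) := (hζ.isUnit_unit h0).eq_orderOf.symm
  have h := tame₀_spec hm (v * gen₀ m ^ t)
  obtain ⟨-, ht⟩ := decomp_gen₀_unique hm hv h.1 h.2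
  have key : (hζ.isUnit h0).unit ^ expo₀ hm (v * gen₀ m ^ t) = (hζ.isUnit h0).unit ^ t :=
    pow_eq_pow_iff_modEq.mpr (by rw [horder]; exact ht.symm)
  have := congrArg Units.val key
  simpa only [secondKindHom, MonoidHom.coe_mk, OneHom.coe_mk, Units.val_pow_eq_pow_val,
    IsUnit.unit_spec] using this

/-- **The second-kind Dirichlet character** `ψ` modulo `M^m` attached to `ζ`. [cite: Sinnott1987, §4.5] -/
def secondKindChar (hm : depth M < m) (hζ : IsPrimitiveRoot ζ (M ^ (m - depth M))) :
    DirichletCharacter K (M ^ m) :=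
  MulChar.ofUnitHom (secondKindHom hm hζ)

/-- **`ψ` is trivial on `V`.** [cite: Sinnott1987, §4.5] -/
theorem secondKindChar_apply_of_isTors (hm : depth M < m) (hζ : IsPrimitiveRoot ζ (M ^ (m - depth M)))
    {u : (ZMod (M ^ m))ˣ} (hu : IsTors u) : secondKindChar hm hζ u = 1 := by
  rw [secondKindChar, MulChar.ofUnitHom_coe]
  have := secondKindHom_apply_decomp hm hζ hu 0
  rwa [pow_zero, mul_one, pow_zero] at this

/-- **`ker ψ ⊆ V`.** [cite: Sinnott1987, §4.5] -/
theorem isTors_of_secondKindChar_eq_one (hm : depth M < m) (hζ : IsPrimitiveRoot ζ (M ^ (m - depth M)))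
    {u : (ZMod (M ^ m))ˣ} (hu : secondKindChar hm hζ u = 1) : IsTors u := by
  rw [secondKindChar, MulChar.ofUnitHom_coe] at hu
  have h := tame₀_spec hm u
  have hval := secondKindHom_apply_decomp hm hζ h.1 (expo₀ hm u)
  rw [← h.2, hu] at hval
  have hval' : ζ ^ expo₀ hm u = 1 := by simpa using hval.symm
  have hdvd : M ^ (m - depth M) ∣ expo₀ hm u := (hζ.pow_eq_one_iff_dvd _).mp hval'
  have hpow : (gen₀ m : (ZMod (M ^ m))ˣ) ^ expo₀ hm u = 1 := by
    rw [← orderOf_gen₀ hm.le] at hdvd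
    exact orderOf_dvd_iff_pow_eq_one.mp hdvd
  rw [h.2, hpow, mul_one]
  exact h.1

/-- **`ψ` is primitive of conductor `M^m`**: it is non-trivial on `1 + M^{m-1} ∈ U`, which is
`≡ 1 (mod M^{m-1})`. [cite: Sinnott1987, §4.5] [cite: Washington1997, §7.2] -/
theorem isPrimitive_secondKindChar (hm : depth M < m) (hζ : IsPrimitiveRoot ζ (M ^ (m - depth M))) :
    (secondKindChar hm hζ).IsPrimitive := by
  classical
  have hm1 : 1 ≤ m := le_trans (one_le_depth M) hm.le
  set ψ := secondKindChar hm hζ with hψ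
  -- the unit `u₁ = 1 + M^{m-1}`
  set u₁ : (ZMod (M ^ m))ˣ := unitOneAdd m (m - 1) 1 with hu₁
  have hlt : 1 < M ^ (m - (m - 1)) := by
    rw [Nat.sub_sub_self hm1, pow_one]; exact hM.out.one_lt
  have hj1 : 1 ≤ m - 1 := by have := one_le_depth M; omega
  have hu₁val : ((u₁ : (ZMod (M ^ m))ˣ) : ZMod (M ^ m)).val = 1 + M ^ (m - 1) := by
    rw [hu₁, val_unitOneAdd (m := m) hj1 (Nat.sub_le m 1) hlt, mul_one]
  haveI hF : Fact (1 < M ^ m) := ⟨Nat.one_lt_pow (by omega) hM.out.one_lt⟩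
  have hu₁ne : u₁ ≠ 1 := by
    intro h
    have hv1 := congrArg (fun u : (ZMod (M ^ m))ˣ ↦ (u : ZMod (M ^ m)).val) h
    simp only [hu₁val, Units.val_one, ZMod.val_one] at hv1
    have : 0 < M ^ (m - 1) := pow_pos hM.out.pos _
    omega
  have hu₁U : CongOne (depth M) ((u₁ : (ZMod (M ^ m))ˣ) : ZMod (M ^ m)) :=
    (congOne_unitOneAdd (m := m) hj1 (Nat.sub_le m 1) hlt).mono (by omega)
  have hψu₁ : ψ u₁ ≠ 1 := by
    intro h
    have htors := isTors_of_secondKindChar_eq_one hm hζ h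
    exact hu₁ne (eq_one_of_isTors_of_congOne hm.le htors hu₁U)
  -- `u₁ ≡ 1 (mod M^{m-1})`
  have hker : ZMod.unitsMap (pow_dvd_pow M (Nat.sub_le m 1)) u₁ = 1 := by
    apply Units.ext
    rw [ZMod.unitsMap_val, Units.val_one, ZMod.cast_eq_val, hu₁val]
    push_cast
    rw [← Nat.cast_pow, ZMod.natCast_self, add_zero]
  -- `ψ` does not factor through `M^{m-1}`
  have hnot : ¬ ψ.FactorsThrough (M ^ (m - 1)) := by
    intro hfac
    have hle := (DirichletCharacter.factorsThrough_iff_ker_unitsMap (pow_dvd_pow M (Nat.sub_le m 1))).mp hfac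
    have h1 : u₁ ∈ (ZMod.unitsMap (pow_dvd_pow M (Nat.sub_le m 1))).ker := by
      rw [MonoidHom.mem_ker]; exact hker
    have h2 := hle h1
    rw [MonoidHom.mem_ker] at h2
    apply hψu₁
    have := congrArg Units.val h2
    rwa [MulChar.coe_toUnitHom, Units.val_one] at this
  -- hence the conductor is `M^m`
  rw [DirichletCharacter.isPrimitive_def]
  obtain ⟨i, hi, hci⟩ := (Nat.dvd_prime_pow hM.out).mp (DirichletCharacter.conductor_dvd_level ψ)
  rw [hci]
  rcases hi.lt_or_eq with hlt' | rfl
  · exfalso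
    apply hnot
    have hfac : ψ.FactorsThrough (M ^ i) := by
      rw [← hci]; exact DirichletCharacter.factorsThrough_conductor ψ
    have him : i ≤ m - 1 := by omega
    exact DirichletCharacter.FactorsThrough.mono ψ hfac (pow_dvd_pow M him)
      (pow_dvd_pow M (Nat.sub_le m 1))
  · rfl

/-- **Existence of primitive second-kind characters with kernel exactly `V`**: for a prime `M`,
`m > depth M`, and a field `K` with a primitive `M^{m - depth M}`-th root of unity, there is a
primitive Dirichlet character `ψ` modulo `M^m` with `ψ(u) = 1 ↔ u ∈ V`.
[cite: Sinnott1987, §4.5] [cite: Washington1997, §7.2] -/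
theorem exists_secondKind (hm : depth M < m) (hζ : IsPrimitiveRoot ζ (M ^ (m - depth M))) :
    ∃ ψ : DirichletCharacter K (M ^ m), ψ.IsPrimitive ∧
      (∀ u : (ZMod (M ^ m))ˣ, IsTors u → ψ u = 1) ∧ (∀ u : (ZMod (M ^ m))ˣ, ψ u = 1 → IsTors u) :=
  ⟨secondKindChar hm hζ, isPrimitive_secondKindChar hm hζ,
    fun _ hu ↦ secondKindChar_apply_of_isTors hm hζ hu,
    fun _ hu ↦ isTors_of_secondKindChar_eq_one hm hζ hu⟩

end Char

/-- **Second-kind characters over `ℂ`**: for every `m > depth M` there is a primitive Dirichlet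
character `ψ` modulo `M^m` with values in `ℂ` and `ψ(u) = 1 ↔ u ∈ V`. [cite: Sinnott1987, §4.5] -/
theorem exists_secondKind_complex (hm : depth M < m) :
    ∃ ψ : DirichletCharacter ℂ (M ^ m), ψ.IsPrimitive ∧
      (∀ u : (ZMod (M ^ m))ˣ, IsTors u → ψ u = 1) ∧ (∀ u : (ZMod (M ^ m))ˣ, ψ u = 1 → IsTors u) :=
  exists_secondKind hm (Complex.isPrimitiveRoot_exp _ (pow_ne_zero _ hM.out.ne_zero))

end Literature.NumberTheory.LFunctions.Sinnott1987
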